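import Summits.CriticalPhenomena.Ising3DConformalLimit.Theorems.SynchronousCouplingRotationJoiningIsotropyNearField
import Summits.CriticalPhenomena.Ising3DConformalLimit.Theorems.SynchronousCouplingRotationJoiningTiltGeometry
import Summits.CriticalPhenomena.Ising3DConformalLimit.Theorems.SynchronousCouplingRotationJoiningTwoPointToolkit
import Summits.CriticalPhenomena.Ising3DConformalLimit.Theorems.EnergyNotSigmaSquaredMoebiusLimitExistsPinnedTwoPoint
import HarnessLib

/-!
# Route `SynchronousCoupling`, crux `RotationJoining` (stmt-CriticalPhenomena-18763), line `SketchIdeator2` (reshape 2) —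
# near-field control for a general cell family, and the lattice geometry of "key-closeness" (lead's tools for stub F)

* `nearSum_generic_le`: for cells `Pₗ ⊆ ℤ³` (`l ∈ Fin k`) of size `≤ n³`, a "key" map `κ : ℤ³ → ℤ³` (the identity for
  axis cells, Kozma's `ψ` for tilted cells) such that `κ`-closeness `|κ(x) − κ(x')|_∞ < rn` forces `|x − x'|_∞ ≤ L'`,
  a bound `U` for the two-point row sums between the cells and a bound `u` for row sums over `L'`-close sites, the
  smeared `k`-point correlator summed over the configurations having SOME `κ`-close pair is at most
  `k² · √((n³u)² + 2 n³ (2L'+1)³ U²) · √((2j)!/(2ʲ j!) (n³U)^j)`, `j = k − 2`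
  (union bound over ordered pairs + `constrainedSum_bound'` + `card_closePairs_le`);
* lattice geometry: `ψ`-closeness and identity-closeness force coordinate closeness (`abs_sub_le_of_psi_close'`,
  `abs_sub_le_of_id_close`), window bounds for points of axis / tilted cells, floor bookkeeping;
* `near_rowSum_sq`: the arithmetic of the near row-sum bound; `rhoPin_sq_blockCov_le`: `ρ_pin(1/n)² V(n) ≤ B n⁶` from
  `TwoPointScaling` (i); `sum_near_tilt_reindex`: the tilted near sum re-indexed over axis cells through `ψ⁻¹`.
References: C. M. Newman, Comm. Math. Phys. 41 (1975); M. Aizenman, H. Duminil-Copin, Ann. Math. 194 (2021) §6.3.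
No definitions, no sorry.
-/

noncomputable section

namespace Summit.CriticalPhenomena.Ising3DConformalLimit.Cruxes.RotationJoining.RateSplitting

open MeasureTheory Filter Literature.Probability.LatticeModels Finset
open scoped BigOperators Topology
open Summit.CriticalPhenomena.Ising3DConformalLimit.MoebiusLimitExistsOnlyInteraction (rhoPin rhoPin_sq)
open Summit.CriticalPhenomena.Ising3DConformalLimit.Cruxes.ExistsScaleCovariantLimit.MonotoneBlockingPort
  (blockCov blockCov_zero_pos BlockTwoLimits stub_twoPointScaling_of_lattice stub_blockCovAlgebra stub_blockCovTwoPointBounds)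
open Summit.CriticalPhenomena.Ising3DConformalLimit.Theses

/-- **Near-field bound for a general cell family.** See the module docstring. [cite: AizenmanDuminilCopinAnnals2021, arXiv:1912.07973 §6.3] -/
theorem nearSum_generic_le (hNB : NewmanBlocks) {k n : ℕ} (P : Fin k → Finset (Site 3)) (κ : Site 3 → Site 3)
    (r : ℝ) (L' : ℕ) (hcard : ∀ l, ((P l).card : ℝ) ≤ (n : ℝ) ^ 3)
    (hclose : ∀ x x' : Site 3, (∀ i, |((κ x i : ℤ) : ℝ) - ((κ x' i : ℤ) : ℝ)| < r * n) → ∀ i, |x i - x' i| ≤ L')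
    {U u : ℝ} (hU0 : 0 ≤ U) (hu0 : 0 ≤ u)
    (hU : ∀ (l l' : Fin k), ∀ x ∈ P l', ∑ y ∈ P l, criticalTwoPoint 3 (y - x) ≤ U)
    (hu : ∀ (Q : Finset (Site 3)) (p : Site 3), (∀ q ∈ Q, ∀ i, |q i - p i| ≤ L') →
      ∑ q ∈ Q, criticalTwoPoint 3 (q - p) ≤ u) :
    ∑ y ∈ (Fintype.piFinset P).filter
        (fun y => ∃ a b, a ≠ b ∧ ∀ i, |((κ (y a) i : ℤ) : ℝ) - ((κ (y b) i : ℤ) : ℝ)| < r * n),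
        criticalCorr 3 k y ≤
      (k : ℝ) ^ 2 * (Real.sqrt (((n : ℝ) ^ 3 * u) ^ 2 + 2 * ((n : ℝ) ^ 3 * (2 * (L' : ℝ) + 1) ^ 3) * U ^ 2) *
        Real.sqrt (((2 * (k - 2)).factorial : ℝ) / (2 ^ (k - 2) * (k - 2).factorial) * ((n : ℝ) ^ 3 * U) ^ (k - 2))) := by
  classical
  set Rel : Fin k → Fin k → (Fin k → Site 3) → Prop :=
    fun a b y => ∀ i, |((κ (y a) i : ℤ) : ℝ) - ((κ (y b) i : ℤ) : ℝ)| < r * n with hRel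
  set B : ℝ := Real.sqrt (((n : ℝ) ^ 3 * u) ^ 2 + 2 * ((n : ℝ) ^ 3 * (2 * (L' : ℝ) + 1) ^ 3) * U ^ 2) *
    Real.sqrt (((2 * (k - 2)).factorial : ℝ) / (2 ^ (k - 2) * (k - 2).factorial) * ((n : ℝ) ^ 3 * U) ^ (k - 2)) with hB
  have hB0 : 0 ≤ B := mul_nonneg (Real.sqrt_nonneg _) (Real.sqrt_nonneg _)
  have hG : ∀ y ∈ Fintype.piFinset P, 0 ≤ criticalCorr 3 k y := fun y _ =>
    Summit.CriticalPhenomena.Ising3DConformalLimit.Theorems.GapForcesFarMerging.Negative.criticalCorr_nonneg' y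
  -- union bound over ordered pairs
  have h1 := sum_filter_exists_pair_le (Fintype.piFinset P) Rel (fun y => criticalCorr 3 k y) hG
  refine h1.trans ?_
  -- each ordered pair contributes at most `B`
  have hpair : ∀ a b : Fin k, ∑ y ∈ (Fintype.piFinset P).filter (fun y => a ≠ b ∧ Rel a b y), criticalCorr 3 k y ≤ B := by
    intro a b
    by_cases hab : a = b
    · have : (Fintype.piFinset P).filter (fun y => a ≠ b ∧ Rel a b y) = ∅ := by
        rw [Finset.filter_eq_empty_iff]; intro y _ h; exact h.1 hab
      rw [this, Finset.sum_empty]; exact hB0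
    -- the constrained pairs
    set C : Finset (Site 3 × Site 3) :=
      (P a ×ˢ P b).filter (fun c => ∀ i, |((κ c.1 i : ℤ) : ℝ) - ((κ c.2 i : ℤ) : ℝ)| < r * n) with hC
    have hCsub : C ⊆ P a ×ˢ P b := Finset.filter_subset _ _
    have hfilt : (Fintype.piFinset P).filter (fun y => a ≠ b ∧ Rel a b y) =
        (Fintype.piFinset P).filter (fun y => (y a, y b) ∈ C) := by
      refine Finset.filter_congr fun y hy => ?_
      rw [Fintype.mem_piFinset] at hy
      simp only [hC, Finset.mem_filter, Finset.mem_product, hRel]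
      exact ⟨fun h => ⟨⟨hy a, hy b⟩, h.2⟩, fun h => ⟨hab, h.2⟩⟩
    rw [hfilt]
    have hcloseC : ∀ c ∈ C, ∀ i, |c.1 i - c.2 i| ≤ L' := by
      intro c hc
      rw [hC, Finset.mem_filter] at hc
      exact hclose c.1 c.2 hc.2
    have hcardC : (C.card : ℝ) ≤ (n : ℝ) ^ 3 * (2 * (L' : ℝ) + 1) ^ 3 :=
      (card_closePairs_le (P a) (P b) C hCsub L' hcloseC).trans
        (mul_le_mul_of_nonneg_right (hcard a) (by positivity))
    have huC : ∀ p ∈ P a, ∑ q ∈ (P b).filter (fun q => (p, q) ∈ C), criticalTwoPoint 3 (q - p) ≤ u := by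
      intro p _
      refine hu _ p fun q hq i => ?_
      rw [Finset.mem_filter] at hq
      have := hcloseC _ hq.2 i
      -- `|p i - q i| ≤ L'` gives `|q i - p i| ≤ L'`
      rw [abs_sub_comm] at this
      exact this
    have h := constrainedSum_bound' hNB P hab C hCsub hU0 hu0 hcard hU huC
    refine h.trans ?_
    rw [hB]
    refine mul_le_mul_of_nonneg_right (Real.sqrt_le_sqrt ?_) (Real.sqrt_nonneg _)
    have : 2 * (C.card : ℝ) * U ^ 2 ≤ 2 * ((n : ℝ) ^ 3 * (2 * (L' : ℝ) + 1) ^ 3) * U ^ 2 :=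
      mul_le_mul_of_nonneg_right (by linarith) (sq_nonneg _)
    linarith
  calc ∑ a, ∑ b, ∑ y ∈ (Fintype.piFinset P).filter (fun y => a ≠ b ∧ Rel a b y), criticalCorr 3 k y
      ≤ ∑ _a : Fin k, ∑ _b : Fin k, B := Finset.sum_le_sum fun a _ => Finset.sum_le_sum fun b _ => hpair a b
    _ = (k : ℝ) ^ 2 * B := by
        rw [Finset.sum_const, Finset.sum_const, Finset.card_univ, Fintype.card_fin, nsmul_eq_mul, nsmul_eq_mul]
        ring


/-! ### Lattice geometry -/

/-- **`ψ`-closeness forces coordinate closeness**: if `|ψ(x)ᵢ − ψ(x')ᵢ| ≤ D` for all `i` then `|xⱼ − x'ⱼ| ≤ 2D + 3` for all `j`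
(`9(x − x') = Aᵀ A (x − x')`, `|A(x−x')ᵢ − 3(ψx − ψx')ᵢ| ≤ 4`, rows of `Aᵀ` have `ℓ¹`-norm `5`). [folklore] -/
theorem abs_sub_le_of_psi_close (x x' : Site 3) (D : ℕ) (h : ∀ i, |psi x i - psi x' i| ≤ D) :
    ∀ j, |x j - x' j| ≤ 2 * (D : ℤ) + 3 := by
  have a0 := TiltGeometry.abs_three_mul_psi_sub_le x 0
  have a1 := TiltGeometry.abs_three_mul_psi_sub_le x 1
  have a2 := TiltGeometry.abs_three_mul_psi_sub_le x 2
  have b0 := TiltGeometry.abs_three_mul_psi_sub_le x' 0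
  have b1 := TiltGeometry.abs_three_mul_psi_sub_le x' 1
  have b2 := TiltGeometry.abs_three_mul_psi_sub_le x' 2
  have h0 := h 0; have h1 := h 1; have h2 := h 2
  rw [A3_mulVec_zero] at a0 b0
  rw [A3_mulVec_one] at a1 b1
  rw [A3_mulVec_two] at a2 b2
  rw [abs_le] at a0 a1 a2 b0 b1 b2 h0 h1 h2
  intro j
  rw [abs_le]
  fin_cases j <;> simp only [Fin.zero_eta, Fin.mk_one, Fin.reduceFinMk] <;> constructor <;> omega

/-- Points of an axis cell of the window have coordinates bounded by `n(m+1)`. [folklore] -/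
theorem abs_le_of_mem_axisCell {n m : ℕ} {v : Fin 3 → ℤ} (hv : ∀ i, |v i| ≤ m) {x : Site 3} (hx : x ∈ axisCell n v) :
    ∀ i, |x i| ≤ (n : ℤ) * ((m : ℤ) + 1) := by
  intro i
  rw [axisCell, Fintype.mem_piFinset] at hx
  have h := hx i
  rw [Finset.mem_Ico] at h
  have hvi := abs_le.1 (hv i)
  have hn : (0:ℤ) ≤ n := by positivity
  have k1 : -((n:ℤ) * m) ≤ (n:ℤ) * v i := by nlinarith
  have k2 : (n:ℤ) * v i ≤ (n:ℤ) * m := mul_le_mul_of_nonneg_left hvi.2 hn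
  rw [abs_le]
  constructor <;> nlinarith

/-- Points of a tilted cell have coordinates bounded by `2n(m+1)` (the bookkeeping box). [folklore] -/
theorem abs_le_of_mem_tiltCell {n m : ℕ} {u : Fin 3 → ℤ} {x : Site 3} (hx : x ∈ tiltCell n m u) :
    ∀ i, |x i| ≤ 2 * (n : ℤ) * ((m : ℤ) + 1) := by
  intro i
  rw [tiltCell, Finset.mem_filter, Fintype.mem_piFinset] at hx
  have h := hx.1 i
  rw [Finset.mem_Icc] at h
  exact abs_le.2 h

/-- An integer whose real cast is `< t` in absolute value is at most `⌊t⌋₊` in absolute value. [folklore] -/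
theorem int_abs_le_floor_of_lt {d : ℤ} {t : ℝ} (h : |(d : ℝ)| < t) : |d| ≤ (⌊t⌋₊ : ℤ) := by
  have ht : 0 ≤ t := le_trans (abs_nonneg _) h.le
  have h1 : ((|d| : ℤ) : ℝ) < t := by push_cast; exact h
  have h2 : (|d| : ℤ) ≤ ⌊t⌋ := by
    rw [Int.le_floor]; exact h1.le
  have h3 : (⌊t⌋ : ℤ) = ((⌊t⌋₊ : ℕ) : ℤ) := by
    rw [Int.natCast_floor_eq_floor ht]
  rw [h3] at h2
  exact h2

/-- Coordinate differences between points of two axis cells of the window are `≤ 2·(2(m+1))·n`. [folklore] -/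
theorem abs_sub_le_window_axis {n m : ℕ} {v v' : Fin 3 → ℤ} (hv : ∀ i, |v i| ≤ m) (hv' : ∀ i, |v' i| ≤ m)
    {x y : Site 3} (hx : x ∈ axisCell n v') (hy : y ∈ axisCell n v) (i : Fin 3) :
    |y i - x i| ≤ 2 * (2 * ((m : ℤ) + 1)) * n := by
  have h1 := abs_le_of_mem_axisCell hv' hx i
  have h2 := abs_le_of_mem_axisCell hv hy i
  rw [abs_le] at h1 h2 ⊢
  have hnm : (0:ℤ) ≤ (n:ℤ) * ((m:ℤ) + 1) := by positivity
  constructor <;> nlinarith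

/-- Coordinate differences between points of two tilted cells are `≤ 2·(2(m+1))·n`. [folklore] -/
theorem abs_sub_le_window_tilt {n m : ℕ} {u u' : Fin 3 → ℤ} {x y : Site 3} (hx : x ∈ tiltCell n m u')
    (hy : y ∈ tiltCell n m u) (i : Fin 3) : |y i - x i| ≤ 2 * (2 * ((m : ℤ) + 1)) * n := by
  have h1 := abs_le_of_mem_tiltCell hx i
  have h2 := abs_le_of_mem_tiltCell hy i
  rw [abs_le] at h1 h2 ⊢
  have hnm : (0:ℤ) ≤ (n:ℤ) * ((m:ℤ) + 1) := by positivity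
  constructor <;> nlinarith

/-- `2⌊t⌋₊ ≤ ⌊2t⌋₊` for `t ≥ 0`. [folklore] -/
theorem two_mul_floor_le {t : ℝ} (ht : 0 ≤ t) : 2 * ⌊t⌋₊ ≤ ⌊2 * t⌋₊ := by
  have h3 : ((2 * ⌊t⌋₊ : ℕ) : ℝ) < ⌊2 * t⌋₊ + 1 := by
    push_cast
    calc 2 * (⌊t⌋₊ : ℝ) ≤ 2 * t := by have := Nat.floor_le ht; linarith
      _ < ⌊2 * t⌋₊ + 1 := Nat.lt_floor_add_one _
  have h4 : 2 * ⌊t⌋₊ < ⌊2 * t⌋₊ + 1 := by exact_mod_cast h3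
  exact Nat.lt_add_one_iff.mp h4

/-- Axis closeness: `|xᵢ − x'ᵢ| < rn` (reals) gives `|xᵢ − x'ᵢ| ≤ ⌊2rn⌋₊ + 5`. [folklore] -/
theorem abs_sub_le_of_id_close {r : ℝ} {n : ℕ} (hr : 0 ≤ r) (x x' : Site 3)
    (hx : ∀ i, |((id x i : ℤ) : ℝ) - ((id x' i : ℤ) : ℝ)| < r * n) (i : Fin 3) :
    |x i - x' i| ≤ ((⌊2 * r * n⌋₊ + 5 : ℕ) : ℤ) := by
  have hx' : |((x i - x' i : ℤ) : ℝ)| < r * n := by push_cast; exact hx i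
  have h1 := int_abs_le_floor_of_lt hx'
  have h2 : ⌊r * n⌋₊ ≤ ⌊2 * r * n⌋₊ + 5 :=
    (Nat.floor_le_floor (by nlinarith [mul_nonneg hr (Nat.cast_nonneg (α := ℝ) n)])).trans (Nat.le_add_right _ _)
  exact h1.trans (by exact_mod_cast h2)

/-- Tilted closeness: `|ψ(x)ᵢ − ψ(x')ᵢ| < rn` (reals) gives `|xⱼ − x'ⱼ| ≤ ⌊2rn⌋₊ + 5`. [folklore] -/
theorem abs_sub_le_of_psi_close' {r : ℝ} {n : ℕ} (hr : 0 ≤ r) (x x' : Site 3)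
    (hx : ∀ i, |((psi x i : ℤ) : ℝ) - ((psi x' i : ℤ) : ℝ)| < r * n) (j : Fin 3) :
    |x j - x' j| ≤ ((⌊2 * r * n⌋₊ + 5 : ℕ) : ℤ) := by
  have hD' : ∀ i, |psi x i - psi x' i| ≤ (⌊r * n⌋₊ : ℕ) := fun i => by
    have hx' : |((psi x i - psi x' i : ℤ) : ℝ)| < r * n := by push_cast; exact hx i
    exact int_abs_le_floor_of_lt hx'
  have h1 := abs_sub_le_of_psi_close x x' _ hD' j
  have h2 := two_mul_floor_le (mul_nonneg hr (Nat.cast_nonneg (α := ℝ) n))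
  rw [show (2 : ℝ) * (r * n) = 2 * r * n by ring] at h2
  have h6 : ((2 * ⌊r * n⌋₊ : ℕ) : ℤ) ≤ ((⌊2 * r * n⌋₊ : ℕ) : ℤ) := by exact_mod_cast h2
  refine h1.trans ?_
  push_cast at h6 ⊢
  linarith

/-! ### Arithmetic of the near row-sum bound -/

/-- The algebra of the near row-sum bound: `(n³ · A' (L'^{1/2} n^{-7/2}) V)² = A'² (L'/n) V²`. [folklore] -/
theorem near_rowSum_sq {n L' : ℕ} (hn : 0 < n) (A' V : ℝ) :
    ((n : ℝ) ^ 3 * (A' * (((L' : ℝ) ^ (1 / 2 : ℝ)) * (n : ℝ) ^ (-(7 / 2 : ℝ))) * V)) ^ 2 =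
      A' ^ 2 * ((L' : ℝ) / n) * V ^ 2 := by
  have hn' : (0:ℝ) < n := by exact_mod_cast hn
  have hL : (0:ℝ) ≤ L' := Nat.cast_nonneg _
  have e1 : (((L' : ℝ) ^ (1 / 2 : ℝ))) ^ 2 = L' := by
    rw [← Real.rpow_natCast, ← Real.rpow_mul hL]; norm_num
  have e2 : ((n : ℝ) ^ (-(7 / 2 : ℝ))) ^ 2 = ((n : ℝ) ^ 7)⁻¹ := by
    rw [← Real.rpow_natCast _ 2, ← Real.rpow_mul hn'.le, ← Real.rpow_natCast _ 7, ← Real.rpow_neg hn'.le]; norm_num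
  calc ((n : ℝ) ^ 3 * (A' * (((L' : ℝ) ^ (1 / 2 : ℝ)) * (n : ℝ) ^ (-(7 / 2 : ℝ))) * V)) ^ 2
      = ((n:ℝ) ^ 3) ^ 2 * A' ^ 2 * ((((L' : ℝ) ^ (1 / 2 : ℝ))) ^ 2 * (((n : ℝ) ^ (-(7 / 2 : ℝ))) ^ 2)) * V ^ 2 := by ring
    _ = ((n:ℝ) ^ 3) ^ 2 * A' ^ 2 * ((L' : ℝ) * ((n : ℝ) ^ 7)⁻¹) * V ^ 2 := by rw [e1, e2]
    _ = A' ^ 2 * ((L' : ℝ) / n) * V ^ 2 := by field_simp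

/-! ### Two inputs of (A1): `ρ_pin(1/n)² V(n) ≤ B n⁶` and the reindexing of the tilted near sum -/

/-- **`ρ_pin(1/n)² V(n) ≤ B n⁶`** from `TwoPointScaling` (i) (the sequence `V(m)/(m⁶ g(m))` converges, hence is bounded) and
`ρ_pin(1/n)² = g(n)⁻¹`. [folklore] -/
theorem rhoPin_sq_blockCov_le (hDJ : SynchronousCoupling.DilationJoinings) (hUR : SynchronousCoupling.UniformRegularity) :
    ∃ BV : ℝ, ∀ n : ℕ, 1 ≤ n → rhoPin (1 / (n : ℝ)) ^ 2 * blockCov n 0 ≤ BV * (n : ℝ) ^ 6 := by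
  have hBL := Cruxes.JoiningsTransfer.Sketch.blockLimits_of_joinings hDJ hUR
  have hBTL : BlockTwoLimits := fun k hk => hBL 2 le_rfl k hk
  obtain ⟨⟨Φ, hΦ, hlim⟩, -⟩ := stub_twoPointScaling_of_lattice stub_blockCovAlgebra stub_blockCovTwoPointBounds hBTL
  -- the inverse sequence converges to `Φ⁻¹`, hence is bounded
  have hinv := hlim.inv₀ hΦ.ne'
  obtain ⟨B, hB⟩ := (Metric.isBounded_range_of_tendsto _ hinv).exists_norm_le
  refine ⟨B, fun n hn => ?_⟩
  have hg : 0 < criticalTwoPoint 3 (Pi.single 0 (n : ℤ)) := criticalTwoPoint_axis_pos n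
  have hn0 : (n : ℝ) ≠ 0 := by exact_mod_cast (show n ≠ 0 by omega)
  have hρ : rhoPin (1 / (n : ℝ)) ^ 2 = (criticalTwoPoint 3 (Pi.single 0 (n : ℤ)))⁻¹ := by
    rw [rhoPin_sq, one_div_one_div, Int.floor_natCast]
  have hBn := hB _ ⟨n, rfl⟩
  rw [Real.norm_eq_abs] at hBn
  have hBn' : (((n : ℝ) ^ 6 * criticalTwoPoint 3 (Pi.single 0 (n : ℤ)) / blockCov n 0)⁻¹) ≤ B := (le_abs_self _).trans hBn
  rw [inv_div] at hBn'
  have hden : 0 < (n : ℝ) ^ 6 * criticalTwoPoint 3 (Pi.single 0 (n : ℤ)) := by positivity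
  rw [div_le_iff₀ hden] at hBn'
  rw [hρ]
  calc (criticalTwoPoint 3 (Pi.single 0 (n : ℤ)))⁻¹ * blockCov n 0
      = blockCov n 0 / criticalTwoPoint 3 (Pi.single 0 (n : ℤ)) := by rw [inv_mul_eq_div]
    _ ≤ B * (n : ℝ) ^ 6 := by
        rw [div_le_iff₀ hg]
        calc blockCov n 0 ≤ B * ((n : ℝ) ^ 6 * criticalTwoPoint 3 (Pi.single 0 (n : ℤ))) := hBn'
          _ = B * (n : ℝ) ^ 6 * criticalTwoPoint 3 (Pi.single 0 (n : ℤ)) := by ring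

/-- Reindexing the tilted near sum: `Σ_{y ∈ ∏ axis, near(y)} G(ψ⁻¹∘y) = Σ_{y' ∈ ∏ tilt, near(ψ∘y')} G(y')`. [folklore] -/
theorem sum_near_tilt_reindex {k : ℕ} (n m : ℕ) (w : Fin k → (Fin 3 → ℤ)) (hw : ∀ l i, |w l i| ≤ m) (r : ℝ)
    (G : (Fin k → Site 3) → ℝ) :
    ∑ y ∈ (Fintype.piFinset (fun l => axisCell n (w l))).filter
        (fun y => ∃ a b, a ≠ b ∧ ∀ i, |((y a i : ℤ) : ℝ) - ((y b i : ℤ) : ℝ)| < r * n), G (fun l => psiInv (y l)) =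
      ∑ y ∈ (Fintype.piFinset (fun l => tiltCell n m (w l))).filter
        (fun y => ∃ a b, a ≠ b ∧ ∀ i, |((psi (y a) i : ℤ) : ℝ) - ((psi (y b) i : ℤ) : ℝ)| < r * n), G y := by
  classical
  rw [Finset.sum_filter, Finset.sum_filter,
    sum_piFinset_tiltCell_eq stub_tiltGeometry n m w hw
      (fun y => if (∃ a b, a ≠ b ∧ ∀ i, |((psi (y a) i : ℤ) : ℝ) - ((psi (y b) i : ℤ) : ℝ)| < r * n) then G y else 0)]
  refine Finset.sum_congr rfl fun y _ => ?_
  simp only [TiltGeometry.psi_psiInv]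

end Summit.CriticalPhenomena.Ising3DConformalLimit.Cruxes.RotationJoining.RateSplitting

end
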